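import Summits.BirchSwinnertonDyer.BirchSwinnertonDyer.Theorems.KatoDescentPotSupersingularReducibleUpperCyclotomicBorel
import Summits.BirchSwinnertonDyer.BirchSwinnertonDyer.Theorems.KatoDescentPotSupersingularReducibleFineSelmerImaginaryQuadraticThree
import HarnessLib

/-!
# Crux M's SHARP member inequality and U₀-red's upper half on EVERY reducible row at `p = 3`, from {modularity, GZK, Fine, H2X⁺}
# ⊕ «`μ₃ = 0` for imaginary quadratic fields» — Ferrero–Washington's use confined to ONE imaginary quadratic field by reflection
# (route-free helper for crux M = stmt-BirchSwinnertonDyer-19196 `ReducibleKatoMember`, K9 / K8-t′; seat `bsd-potss-rkm` g36)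

WHY.  g34: on all rows, M ⟸ {modularity, Fine, H2X⁺, FW}; g35: FW idle on the cyclotomic-Borel rows.  This generation proved
Leopoldt–Scholz reflection up the cyclotomic tower (`Literature/NumberTheory/IwasawaTheory/ClassicalMuVanishesReflection{Layer,Descent}`)
and the intrinsic Galois data of the Borel field at `p = 3` (`…ReducibleFineSelmerImaginaryQuadraticThree`): (A) at `(W', 3)` holds for
EVERY `W'/ℚ` with `W'[3]` reducible GIVEN ONLY `H_IQ` := «`μ = 0` for every cyclotomic `ℤ₃`-extension of every imaginary quadratic
field».  Since reducibility passes along the isogeny `W ∼ W_K` to Kato's member, the per-row engine of g35 runs with `H_IQ` in place of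
the cyclotomic-Borel line:

* `katoMemberShaBoundSharp_three_of_fineInputs_of_imaginaryQuadratic` — for `W/ℚ` globally minimal, additive potentially good at `3`,
  `W[3]` reducible, `L(W,1) ≠ 0`, `Ш(W)` finite: Kato's member `W' ∼ W` has
  `ord₃ #Ш(W')[3^∞] + v₃ Tam(W') ≤ ord₃(L(W',1)/Ω(W')) + 2·ord₃ #W'(ℚ)_tors`, from {modularity, GZK, Fine, H2X⁺, H_IQ};
* `missingUpperBoundAt_three_of_not_irreducible_of_imaginaryQuadratic` — U₀-red's `MissingUpperBoundAt W 3` at `r_an = 0` from the same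
  ⊕ {Cassels, entire `L`};
* the K9 reading: on ALL 9476 O6 X3 r0 classes the `μ`-input of M / U₀-red is `H_IQ` (52 imaginary quadratic fields in the census,
  18 not yet certified by Iwasawa 1956), and `H_IQ ⟸ FW` (`imaginaryQuadratic_mu_of_FW`) so nothing is weaker than before.

HONEST FRAMING.  Theorems only; route-free; closes nothing (crux M — all odd `p` — stays cite-level over Fine, H2X⁺, modularity and FW;
at `p = 3` FW is needed only in its imaginary-quadratic instance); BSD is proved for no curve.
References: [Kato2004Asterisque] Thm. 12.5 (3), §14.14, Prop. 14.16 (2); [Lang1990] Ch. 13 §2 Thm. 2.1 (i); [Washington1997] §10.2 Thm. 10.10,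
§13.3, §7.5; [CoatesSujatha2005] Cor. 3.6; [Wuthrich2014] Lemma 14; [Cassels1965ArithmeticVIII]; tree g33/g34/g35/g36 files of this seat.
-/

-- the summit and its single problem are both named `BirchSwinnertonDyer` (registry layout D-0017)
set_option linter.dupNamespace false
set_option autoImplicit false

noncomputable section

open scoped Classical ContRepresentation NumberField TensorProduct
open CategoryTheory Function Field NumberField IsDedekindDomain WeierstrassCurve CongruenceSubgroup
open Literature.NumberTheory.EllipticCurves Literature.NumberTheory.GaloisRepresentations
  Literature.NumberTheory.GaloisRepresentations.DiscreteGaloisModule Literature.NumberTheory.GaloisCohomology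
open Literature.NumberTheory.EllipticCurves.ModularForms Literature.NumberTheory.EllipticCurves.GreenbergSelmer
open Literature.NumberTheory.EllipticCurves.Kato2004 Literature.NumberTheory.EllipticCurves.Kato2004.EulerSystemValues
open Literature.NumberTheory.EllipticCurves.IwasawaAlgebra Rat.HeightOneSpectrum
open Literature.NumberTheory.EllipticCurves.Rank1Residual Literature.NumberTheory.EllipticCurves.Rank1Residual.Typed
open Literature.NumberTheory.IwasawaTheory
open Summit.BirchSwinnertonDyer.Rank1Residual.X11b.Levels Summit.BirchSwinnertonDyer.Rank1Residual.X11b.LocBridge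
  Summit.BirchSwinnertonDyer.Rank1Residual.X11b.AcSelmer
open Summit.BirchSwinnertonDyer.Rank1Residual Summit.BirchSwinnertonDyer.Rank1Residual.Additive
open Summit.BirchSwinnertonDyer.BirchSwinnertonDyer.Theorems
open Summit.BirchSwinnertonDyer.BirchSwinnertonDyer.Theorems.ASideJunction
open Summit.BirchSwinnertonDyer.BirchSwinnertonDyer.Theorems.KatoFiniteLevelCount
open Summit.BirchSwinnertonDyer.BirchSwinnertonDyer.Theorems.StrictSelmerBridge
open Summit.BirchSwinnertonDyer.BirchSwinnertonDyer.Theorems.IntegralH1LayerZeroTop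
open Summit.BirchSwinnertonDyer.BirchSwinnertonDyer.Theorems.MemberIndexOfValue
open Summit.BirchSwinnertonDyer.BirchSwinnertonDyer.Theorems.MemberHullZetaInputsOfCore
open Summit.BirchSwinnertonDyer.BirchSwinnertonDyer.Theorems.ReducibleUpperOfCoreInputs
open Summit.BirchSwinnertonDyer.BirchSwinnertonDyer.Theorems.ReducibleUpperCyclotomicBorel

namespace Summit.BirchSwinnertonDyer.BirchSwinnertonDyer.Theorems.ReducibleUpperImaginaryQuadraticThree

/-! ## §1 The sharp member inequality at Kato's member on every reducible row at `p = 3` -/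

/-- **THE SHARP MEMBER BOUND on EVERY reducible row at `p = 3`, from Kato's two facts, modularity, GZK and `H_IQ` («`μ₃ = 0` for every
cyclotomic `ℤ₃`-extension of every imaginary quadratic field») — Ferrero–Washington only in its imaginary-quadratic instance.**  For `W/ℚ`
globally minimal, additive potentially good at `3`, `W[3]` reducible, `L(W,1) ≠ 0`, `Ш(W)` finite: Kato's member `W' ∼ W` satisfies
`ord₃ #Ш(W')[3^∞] + v₃ Tam(W') ≤ ord₃(L(W',1)/Ω(W')) + 2·ord₃ #W'(ℚ)_tors`.  Proof = g35's `katoMemberShaBoundSharp_of_fineInputs_of_cyclotomicBorel`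
with statement (A) at the member supplied by `fineSelmerDual_moduleFinite_three_of_not_irreducible_of_imaginaryQuadratic` (reducibility
passes along `W ∼ W'`).  [cite: Kato2004Asterisque, Thm. 12.5 (3) (p. 222), §14.14 (p. 243), proof of Prop. 14.16 (pp. 244–245)]
[cite: CoatesSujatha2005, Cor. 3.6] [cite: Lang1990, Ch. 13 §2, Thm. 2.1 (i)] [cite: Washington1997, §10.2 Thm. 10.10 (Scholz)] -/
theorem katoMemberShaBoundSharp_three_of_fineInputs_of_imaginaryQuadratic
    (hmod : exists_isNewformOf) (hGZK : rank_eq_analyticRank_of_analyticRank_le_one)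
    (hF : exists_memberHullZetaFineInputs) (hH : exists_iwasawaH2Data_fineSelmerDual_embedding_count)
    (hIQ : ∀ (M : Type) [Field M] [NumberField M], Module.finrank ℚ M = 2 → ¬ IsTotallyReal M →
      ∀ κM : ZpExtension M 3, κM.IsCyclotomic → ClassicalMuVanishes κM)
    (W : WeierstrassCurve ℚ) [W.IsElliptic] [W.IsGloballyMinimal] [Fact (3 : ℕ).Prime]
    (hng : ¬ W.HasGoodReductionAtPrime 3) (hnm : ¬ W.HasMultiplicativeReductionAtPrime 3)
    (hj : 0 ≤ padicValRat 3 W.j) (hirr : ¬ W.HasIrreducibleModPGaloisRep 3)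
    (hL : W.entireLFunction 1 ≠ 0) (hfin : Finite W.sha) :
    ∃ (W' : WeierstrassCurve ℚ) (_ : W'.IsElliptic) (_ : W'.IsGloballyMinimal),
      IsIsogenous W W' ∧ Finite W'.sha ∧
      ∃ q : ℚ, W'.entireLFunction 1 / (W'.realPeriodRat : ℂ) = (q : ℂ) ∧
        (padicValNat 3 (Nat.card (AddCommGroup.primaryComponent W'.sha 3)) : ℤ) +
            padicValNat 3 W'.tamagawaProduct ≤
          padicValRat 3 q + 2 * (padicValNat 3 W'.torsionOrder : ℤ) := by
  have hpp : (3 : ℕ).Prime := Fact.out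
  have hp : (3 : ℕ) ≠ 2 := by decide
  have hPT : poitouTate_selmerStructure_duality ℚ :=
    poitouTate_selmerStructure_duality_of_conj (InputsPoitouTateSelmer.poitouTate_selmerStructure_duality_conj_holds ℚ)
  -- Kato's member `W'` and the hull data at it
  obtain ⟨W', hE', hM', hiso, hrest⟩ := hF W 3 hp hng hnm hj hirr hL hfin
  haveI := hE'
  haveI := hM'
  haveI : ContinuousSMul ℤ_[3] (W'.tateModule 3) := TateModule.continuousSMul_padicInt
  haveI : Module.Free ℤ_[3] (W'.tateModule 3) := W'.module_free_tateModule_holds 3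
  haveI : Module.Finite ℤ_[3] (W'.tateModule 3) := W'.module_finite_tateModule_holds 3
  -- `W(ℚ)` finite (GZK at analytic rank `0`), transported along the isogeny; `Ш(W')` finite likewise
  have h0 : W.analyticRank = 0 := by
    by_cases hE : W.HasEntireLFunction
    · exact (WeierstrassCurve.analyticRank_eq_zero_iff_holds (W := W) hE).mpr hL
    · exact W.analyticRank_eq_zero_of_not_hasEntireLFunction hE
  obtain ⟨hrk, -⟩ := hGZK W (by rw [h0]; exact zero_le_one)
  rw [h0] at hrk
  haveI hWfin : Finite W.toAffine.Point := (W.mordellWeilRank_eq_zero_iff_finite).mp hrk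
  haveI hW'fin : Finite W'.toAffine.Point := finite_point_of_isIsogenous hiso.symm_of_isElliptic hWfin
  have hfin' : Finite W'.sha := (IsIsogenous.shaFinite_iff_shaFinite hiso).mp hfin
  haveI : Finite W'.sha := hfin'
  haveI : Finite (AddCommGroup.primaryComponent W'.sha 3) := inferInstance
  -- a newform of `W` (modularity) and the zeta-body data of the hull sub-package
  haveI : NeZero (W.conductorNorm ℤ) := ⟨(W.conductorNorm_pos_holds).ne'⟩
  obtain ⟨f, hf⟩ := hmod W
  obtain ⟨κ', Λ', c, d, a, A, z, x, -, -, -, -, hbody, hall⟩ := hrest f hf (fun m => Classical.arbitrary _)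
  -- the cyclotomic `ℤ₃`-tower with a topological generator (PROVED), the pinned `𝐇¹_Γ(T_pW')` (PROVED), the lift `𝐲`
  obtain ⟨κ, hκ, γ, hγ, -⟩ := exists_isCyclotomic_isTopGenerator_isCyclotomicVariable_holds 3
  obtain ⟨I⟩ := Kato2004.nonempty_iwasawaH1Data_holds W' 3 κ γ hκ hγ
  obtain ⟨y, hy⟩ :=
    (IwasawaH1Data.existsUnique_lift_of_zetaBody 3 W' hκ hp I f _ κ' Λ' c d a A z x hbody).exists
  obtain ⟨Z⟩ := hall κ γ hκ hγ I y hy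
  -- statement (A) AT THE MEMBER from `H_IQ`: `W'[3]` is reducible too
  have hirr' : ¬ W'.HasIrreducibleModPGaloisRep 3 := Rank1Residual.not_hasIrreducibleModPGaloisRep_of_isIsogenous hiso hirr
  have hAW' := ReducibleFineSelmerImaginaryQuadraticThree.fineSelmerDual_moduleFinite_three_of_not_irreducible_of_imaginaryQuadratic
    hIQ W' hirr' κ hκ
  -- H2X⁺ at the member (the finiteness of `W'(ℚ_{3,∞})[3^∞]` is a tree theorem at a potentially good prime)
  obtain ⟨φ⟩ := hiso
  have hj' : 0 ≤ padicValRat 3 W'.j := padicValRat_j_nonneg_of_isogeny φ hpp hj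
  let v : HeightOneSpectrum (𝓞 ℚ) := Rat.HeightOneSpectrum.primesEquiv.symm ⟨3, hpp⟩
  have hv : ((Rat.HeightOneSpectrum.primesEquiv v : Nat.Primes) : ℕ) = 3 := by
    simp only [v, Equiv.apply_symm_apply]
  have hfinI : Finite (FixedPoints.addSubgroup ↥(κ.kerSubgroup ⊓ decomp v) (W'.geomPrimaryTorsion 3)) :=
    TowerTorsionFiniteOrdinary.finite_fixedPoints_kerSubgroup_inf_decomp_of_padicValRat_j_nonneg W' 3 hp hj' κ hκ v hv
  obtain ⟨J, eX, heX, hcokX, hcnt⟩ := hH W' 3 κ γ hγ v hp hκ hv hfinI I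
  -- the core package per pin, and the sharp member inequality
  obtain ⟨Zc⟩ := FineInputsCharForm.nonempty_coreInputs_of_fineInputs_of_moduleFinite W' 3 hAW' hγ Z J eX heX hcokX
    (hcnt inferInstance inferInstance)
  exact ⟨W', hE', hM', ⟨φ⟩, hfin', Zc.sha_add_tamagawa_le_of_PT hκ hγ hPT hp⟩

/-! ## §2 U₀-red's upper half on every reducible row at `p = 3` -/

/-- **U₀-red's `MissingUpperBoundAt W 3` at `r_an = 0` on EVERY reducible row, from {modularity, GZK, Cassels, entire `L`, Fine, H2X⁺}
⊕ `H_IQ`** (g35's `missingUpperBoundAt_of_fineInputs_of_cyclotomicBorel` with §1 in place of the cyclotomic-Borel line).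
[cite: Kato2004Asterisque, proof of Prop. 14.16 (pp. 244–245), §14.14 (p. 243)] [cite: Cassels1965ArithmeticVIII]
[cite: Miller2011LMS, Def. 1.1] -/
theorem missingUpperBoundAt_three_of_not_irreducible_of_imaginaryQuadratic
    (hmod : exists_isNewformOf) (hGZK : rank_eq_analyticRank_of_analyticRank_le_one)
    (hCassels : bsdRHS_eq_of_isIsogenous) (hmodL : hasEntireLFunction_rat)
    (hF : exists_memberHullZetaFineInputs) (hH : exists_iwasawaH2Data_fineSelmerDual_embedding_count)
    (hIQ : ∀ (M : Type) [Field M] [NumberField M], Module.finrank ℚ M = 2 → ¬ IsTotallyReal M →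
      ∀ κM : ZpExtension M 3, κM.IsCyclotomic → ClassicalMuVanishes κM)
    (W : WeierstrassCurve ℚ) [W.IsElliptic] [W.IsGloballyMinimal] [Fact (3 : ℕ).Prime]
    (hng : ¬ W.HasGoodReductionAtPrime 3) (hnm : ¬ W.HasMultiplicativeReductionAtPrime 3)
    (hj : 0 ≤ padicValRat 3 W.j) (hirr : ¬ W.HasIrreducibleModPGaloisRep 3)
    (hr : W.analyticRank = 0) : MissingUpperBoundAt W 3 := by
  have hL : W.entireLFunction 1 ≠ 0 := (W.analyticRank_eq_zero_iff_holds (hmodL W)).mp hr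
  have hfin : Finite W.sha := (hGZK W (by rw [hr]; exact zero_le_one)).2
  obtain ⟨W', hE', hM', hiso, hfin', q, hq, hle⟩ :=
    katoMemberShaBoundSharp_three_of_fineInputs_of_imaginaryQuadratic hmod hGZK hF hH hIQ W hng hnm hj hirr hL hfin
  haveI := hE'
  haveI := hM'
  have hr' : W'.analyticRank = 0 := by rw [← analyticRank_eq_of_isIsogenous' hiso, hr]
  obtain ⟨q', hq', hv⟩ := exists_shaAn_eq_of_exactCount W' 3 hGZK hmodL hr' (b := 0)
    (a := padicValRat 3 q + 2 * (padicValNat 3 W'.torsionOrder : ℤ) -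
      ((padicValNat 3 (Nat.card (AddCommGroup.primaryComponent W'.sha 3)) : ℤ) +
        padicValNat 3 W'.tamagawaProduct)) hq (by ring)
  have hup' : MissingUpperBoundAt W' 3 := ⟨q', hq', by rw [hv]; linarith⟩
  exact TwistComparison.missingUpperBoundAt_of_isIsogenous W' W 3 hCassels hGZK hmodL
    hiso.symm_of_isElliptic (by rw [hr']; exact zero_le_one) hup'

/-! ## §3 The same with `H_IQ` discharged by Ferrero–Washington (imaginary quadratic instance only) -/

/-- **The sharp member bound on every reducible row at `p = 3`, modulo {modularity, GZK, Fine, H2X⁺} and Ferrero–Washington USED ONLY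
FOR IMAGINARY QUADRATIC FIELDS** (`imaginaryQuadratic_mu_of_FW`). [cite: Kato2004Asterisque, proof of Prop. 14.16 (pp. 244–245)]
[cite: Washington1997, §7.5, §10.2 Thm. 10.10] -/
theorem katoMemberShaBoundSharp_three_of_fineInputs_of_FW_imaginaryQuadratic
    (hmod : exists_isNewformOf) (hGZK : rank_eq_analyticRank_of_analyticRank_le_one)
    (hF : exists_memberHullZetaFineInputs) (hH : exists_iwasawaH2Data_fineSelmerDual_embedding_count)
    (hFW : ferreroWashington1979_classicalMuVanishes)
    (W : WeierstrassCurve ℚ) [W.IsElliptic] [W.IsGloballyMinimal] [Fact (3 : ℕ).Prime]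
    (hng : ¬ W.HasGoodReductionAtPrime 3) (hnm : ¬ W.HasMultiplicativeReductionAtPrime 3)
    (hj : 0 ≤ padicValRat 3 W.j) (hirr : ¬ W.HasIrreducibleModPGaloisRep 3)
    (hL : W.entireLFunction 1 ≠ 0) (hfin : Finite W.sha) :
    ∃ (W' : WeierstrassCurve ℚ) (_ : W'.IsElliptic) (_ : W'.IsGloballyMinimal),
      IsIsogenous W W' ∧ Finite W'.sha ∧
      ∃ q : ℚ, W'.entireLFunction 1 / (W'.realPeriodRat : ℂ) = (q : ℂ) ∧
        (padicValNat 3 (Nat.card (AddCommGroup.primaryComponent W'.sha 3)) : ℤ) +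
            padicValNat 3 W'.tamagawaProduct ≤
          padicValRat 3 q + 2 * (padicValNat 3 W'.torsionOrder : ℤ) :=
  katoMemberShaBoundSharp_three_of_fineInputs_of_imaginaryQuadratic hmod hGZK hF hH
    (fun M _ _ hM hnr κM hκM => ReducibleFineSelmerImaginaryQuadraticThree.imaginaryQuadratic_mu_of_FW hFW M hM hnr κM hκM)
    W hng hnm hj hirr hL hfin

end Summit.BirchSwinnertonDyer.BirchSwinnertonDyer.Theorems.ReducibleUpperImaginaryQuadraticThree

end
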